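import Literature.Computability.Complexity.GateEliminationCase54Leaves
import Literature.Computability.Complexity.GateEliminationCase81Dispatch
import Literature.Computability.Complexity.GateEliminationKResynth

/-!
# Gate elimination: the affine leaf of Case 5.4.2 of Li–Yang's Theorem 4.1

"If `B` is a `2⁺`-gate, then it must be ⊕-type … Since `x` must be unprotected …, we can
substitute `x ← t ⊕ c` such that the output of `B` is fixed regardless of the inputs. We can then
replace `B` by a constant. If `c` is chosen appropriately, we can even further trivialize `E`.
Note that we rewire the circuit such that `G` is fed by `t` instead of `x` to make `x` disconnected
with the circuit, which will not introduce troubled gates. Since `E` and two descendants of them are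
removed by Rule 2 and Rule 3, and … the replacement of `B` by a constant can introduce only `1`
potential increment (caused by `t`), the overall potential increment is bounded by `ΔΦ ≤ 4`, hence
`Δμ ≥ 4 - 4α_φ + α_I ≥ δ`." (ECCC TR21-023, §4.1, Case 5.4.2.) PROVED here as
`stepGoal_affine_B2` in the local form used by the Case 5.4 dispatcher
(`LiYang2022_case5_4_holds_aux`, hypothesis `hF7`).

## References

* J. Li, T. Yang, *3.1n − o(n) circuit lower bounds for explicit functions*, STOC 2022;
  ECCC TR21-023, §2.4 (affine substitution), §4.1 (Case 5.4.2), Lemma 3.11.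
-/

namespace Literature.Computability.Complexity

open Finset

namespace Semicircuit

variable {n : ℕ} {C : Semicircuit n} {k₀ : Fin C.m} {f : (Fin n → ZMod 2) → Bool} {R : RdqSource n} {d : ℕ}
  {αφ αI αQ : ℝ} {G : Fin C.m} {x y : Fin n} {B C' D : Fin C.m} {aX aB aC aD : Fin 2}

/-- **An affine substitution creating no troubled gate**: if afterwards the target variable has
out-degree `≥ 3`, no gate is newly troubled (new troubled gates read the target), so a packing
survives with no larger potential. [cite: LiYang2022, §2.4, Lemma 3.11] -/
theorem exists_packing_substVar_noNew (D : Semicircuit n) (j k : Fin n) (c : Bool) (hjk : k ≠ j)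
    {P : Finset (Fin D.m × Fin D.m)} (hP : D.IsPacking P) (h3 : 3 ≤ (D.substVar j k c).fanout (.var k)) :
    ∃ P' : Finset (Fin D.m × Fin D.m), (D.substVar j k c).IsPacking P' ∧ (D.substVar j k c).potential P' ≤ D.potential P := by
  classical
  have hcover : ∀ g, (D.substVar j k c).Troubled g → ¬ D.Troubled (id g) → g ∈ (∅ : Finset (Fin D.m)) ∨ g ∈ (∅ : Finset (Fin D.m)) := by
    intro g hg hgT
    exfalso
    have hcb := D.causedBy_of_new_troubled_substVar j k c hjk hg hgT
    rcases hcb with h | ⟨z, hz, a, ha⟩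
    · cases h
    · cases hz
      have := Troubled.fanout_eq_two hg ha
      omega
  have hadj : ∀ g g', (D.substVar j k c).Troubled g → (D.substVar j k c).Troubled g' → D.Troubled (id g) → D.Troubled (id g') →
      D.Adjacent (id g) (id g') → (D.substVar j k c).Adjacent g g' := by
    intro g g' _ _ _ _ ⟨z, hz, hz'⟩
    by_cases hzj : z = j
    · subst hzj
      exact ⟨k, D.reads_target_substVar_of_reads z k c hz, D.reads_target_substVar_of_reads z k c hz'⟩
    · exact ⟨z, D.reads_var_substVar_of_ne j k c hzj hz, D.reads_var_substVar_of_ne j k c hzj hz'⟩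
  obtain ⟨P', hP', hpot⟩ := exists_packing_transfer D (D.substVar j k c) id (fun _ _ h => h) hP
    (fun p _ => ⟨⟨p.1, rfl⟩, ⟨p.2, rfl⟩⟩) hadj ∅ ∅ hcover (Or.inl (by simp)) (Or.inl (by simp))
  refine ⟨P', hP', ?_⟩
  simpa using hpot

/-- The gate functions after replacing a constant gate are unchanged (the redirection to a constant needs no
negation). [folklore] -/
theorem elimDataWRedirectConst_op (hF : C.Fair) (hC : C.ComputesRestr f R)
    {P : Finset (Fin C.m × Fin C.m)} (hP : C.IsPacking P) (c : Bool)
    (hid : ∀ (x : Fin n → Bool) (w : Fin C.m → Bool),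
      C.op k₀ (C.nodeVal x w (C.arg k₀ 0)) (C.nodeVal x w (C.arg k₀ 1)) = c)
    (hacc : C.arg k₀ 0 = C.arg k₀ 1 ∨ ∃ (a : Fin 2) (b : Bool), C.arg k₀ a = .const b)
    (hself : ∀ a, C.arg k₀ a ≠ .gate k₀) (hout : C.out ≠ .gate k₀)
    (hφ : 0 ≤ αφ) (hI : 0 ≤ αI) (αQ : ℝ) (k' : Fin (elimDataWRedirectConst hF hC hP c hid hacc hself hout hφ hI αQ).C'.m) :
    (elimDataWRedirectConst hF hC hP c hid hacc hself hout hφ hI αQ).C'.op k' =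
      C.op ((elimDataWRedirectConst hF hC hP c hid hacc hself hout hφ hI αQ).ι k') := by
  funext p q
  show C.op _ (p ^^ (false && _)) (q ^^ (false && _)) = C.op _ p q
  rw [Bool.false_and, Bool.false_and, Bool.xor_false, Bool.xor_false]
  rfl


/-- **Case 5.4.2 of the proof of Thm. 4.1, `B` a ⊕-type `2`-gate** (the affine substitution
`x ← t ⊕ c`): `G` is the ∧-type gate of the configuration of Case 5 (reading the `2`-variables
`x`, `y`), `B` is the other reader of `x`, not ∧-type, reading the variable `t`, with
`fanout(B) = 2`; an ∧-type gate `E` reads `B` (at `aE`) and a variable `z`. Then `x ← t ⊕ c`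
makes `B` constant — with `c` chosen so that the constant trivializes `E` —, and the eliminations
of `B` (constant), `E` (trivialized) and two more doomed gates give `Δμ ≥ 4 - 4α_φ + α_I ≥ δ`.
[cite: LiYang2022, §4.1 (Case 5.4.2), §2.4] -/
theorem stepGoal_affine_B2 (hf : IsAffineDisperser f d) (hd : 2 * d + 2 < R.dim) (hF : C.Fair)
    (hC : C.ComputesRestr f R) (hS : C.Standing R) (hcfg : C.Case5Config G x y B C' D aX aB aC aD)
    (hφ : 0 ≤ αφ) (hI : 0 ≤ αI) (αQ : ℝ) (hBC : B ≠ C')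
    {E : Fin C.m} {aE : Fin 2} {t z : Fin n} (hBn : ¬ IsAndOp (C.op B)) (hBt : C.arg B aB.rev = .var t)
    (hEand : IsAndOp (C.op E)) (hEB : C.arg E aE = .gate B) (hEz : C.arg E aE.rev = .var z) (hB2 : C.fanout (.gate B) = 2) :
    C.StepGoal f R αφ αI αQ := by
  classical
  have hN := hS.normalized.1
  have hBx := hcfg.arg_B
  obtain ⟨eB, heB⟩ : IsXorOp (C.op B) := C.isXorOp_of_isAffineOp hS.nonDegenerate ((isAndOp_or_isAffineOp _).resolve_left hBn)
  have hEK : E ∉ C.xorPart := C.not_mem_xorPart_of_isAndOp hEand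
  have hxt : x ≠ t := by
    intro h
    have e : ∀ a', C.arg B a' = .var x := fun a' => by
      rcases fin2_eq_or_eq_rev aB a' with h' | h'
      · rw [h']; exact hBx
      · rw [h', hBt, h]
    exact hN.arg_zero_ne_arg_one B (by rw [e 0, e 1])
  have hty : t ≠ y := fun h => case5_B_not_y hcfg hBC aB.rev (by rw [hBt, h])
  have hEG : E ≠ G := by
    intro h; rw [h] at hEB
    rcases fin2_eq_or_eq_rev aX aE with e' | e'
    · rw [e', hcfg.arg_G_x] at hEB; cases hEB
    · rw [e', hcfg.arg_G_y] at hEB; cases hEB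
  have hEB' : E ≠ B := fun h => by rw [h] at hEB hEK; exact C.arg_ne_self_of_not_mem hEK _ hEB
  have hzx : z ≠ x := by
    intro h; rw [h] at hEz
    rcases case5_reader_x hcfg hEz with h' | h'
    · exact hEG h'
    · exact hEB' h'
  have hE_x : ∀ a, C.arg E a ≠ .var x := by
    intro a h
    rcases fin2_eq_or_eq_rev aE a with e' | e'
    · rw [e', hEB] at h; cases h
    · rw [e', hEz] at h; cases h; exact hzx rfl
  -- the other reader `F` of `B`
  have hEB1 : (univ.filter fun a : Fin 2 => C.arg E a = .gate B).card ≤ 1 := by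
    rw [card_le_one]
    intro a ha b' hb'
    rw [mem_filter] at ha hb'
    have key : ∀ a', C.arg E a' = .gate B → a' = aE := by
      intro a' h
      rcases fin2_eq_or_eq_rev aE a' with e' | e'
      · exact e'
      · rw [e', hEz] at h; cases h
    rw [key a ha.2, key b' hb'.2]
  obtain ⟨F, aF, hFE, hFB⟩ := exists_reader_ne (by omega) hEB1
  have hFB' : F ≠ B := fun h => by rw [h] at hFB; exact not_reads_self_of_standing hF hN hS.nonDegenerate B aF hFB
  -- the killing value of `E`'s wire to `B`, and the constant of `B` after the substitution
  obtain ⟨kE, hkE⟩ := exists_trivializing hEand aE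
  let b : Bool := kE ^^ eB
  have hcB : ∀ s, (C.substVar x t b).op B s s = kE := by
    intro s
    rw [C.substVar_op_self (fun h => hxt h.symm) hBx hBt]
    split_ifs <;> rw [heB] <;> cases s <;> cases kE <;> cases eB <;> rfl
  -- the source after `x := t ⊕ b`
  have hx : R.Free x := case5_free_x hC hcfg
  have hxp : ¬ R.Protected x := case5_unprot_x hS hcfg
  have ht : R.Free t := free_of_reads hC hBt
  have hxinf : x ∈ C.influential R := C.mem_influential_of_reads R hBx
  have htinf : t ∈ C.influential R := C.mem_influential_of_reads R hBt
  let c' : ZMod 2 := finTwoEquiv.symm b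
  have hb' : finTwoEquiv c' = b := finTwoEquiv.apply_symm_apply b
  let Eq : LinEq n := ⟨{t}, c'⟩
  have hEq : ∀ i ∈ Eq.support, R.lin i = none ∧ i ≠ x := by
    intro i hi
    have : i = t := by simpa [Eq] using hi
    subst this
    exact ⟨ht.1, fun h => hxt h.symm⟩
  let R₁ := R.assignLin x Eq hx hxp hEq
  have hsol : ∀ v, v ∈ R₁.Sol ↔ v ∈ R.Sol ∧ v x = v t + c' := by
    intro v
    rw [RdqSource.mem_sol_assignLin_iff]
    have : Eq.eval v = v t + c' := by
      show c' + ∑ i ∈ ({t} : Finset (Fin n)), v i = _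
      rw [sum_singleton, add_comm]
    rw [this]
  have hfree : ∀ i, R₁.Free i ↔ R.Free i ∧ i ≠ x := RdqSource.free_assignLin_iff hx hxp hEq
  obtain ⟨ko, hko⟩ := exists_out_eq_gate' hf hF hC (by omega)
  have hout : C.out ≠ .var x := by rw [hko]; exact fun h => by cases h
  have hd₁ : 2 * d + 2 ≤ R₁.dim := by
    have := RdqSource.dim_assignLin hx hxp hEq
    show 2 * d + 2 ≤ (R.assignLin x Eq hx hxp hEq).dim; omega
  -- the circuit after `x := t ⊕ b`
  let C₁ := C.substVar x t (finTwoEquiv c')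
  have hF₁ : C₁.Fair := hF.substVar x t _
  have hC₁ : C₁.ComputesRestr f R₁ := hC.substVar (fun h => hxt h.symm) hsol hfree ht hout
  have hfant₁ : C₁.fanout (.var t) = C.fanout (.var t) + 2 := by
    show (C.substVar x t (finTwoEquiv c')).fanout (.var t) = _
    rw [C.fanout_substVar_var_target x t _ (fun h => hxt h.symm), hcfg.fanout_x]
  obtain ⟨P₁, hP₁, hpot₁⟩ := exists_packing_substVar_noNew C x t (finTwoEquiv c') (fun h => hxt h.symm) C.isPacking_empty
    (by have := one_le_fanout_of_arg_eq hBt; change 3 ≤ C₁.fanout (.var t); omega)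
  -- wires of `C₁`
  have hwB : ∀ a, C₁.arg B a = .var t := by
    intro a
    show (C.arg B a).substVar x t = .var t
    rw [Node.substVar_eq_var_target_iff]
    rcases fin2_eq_or_eq_rev aB a with e' | e'
    · rw [e']; exact Or.inl hBx
    · rw [e']; exact Or.inr hBt
  have hgate₁ : ∀ {k : Fin C.m} {a : Fin 2} {g : Fin C.m}, C₁.arg k a = .gate g ↔ C.arg k a = .gate g :=
    fun {k a g} => Node.substVar_eq_gate_iff
  have hEB₁ : C₁.arg E aE = .gate B := hgate₁.mpr hEB
  have hFB₁ : C₁.arg F aF = .gate B := hgate₁.mpr hFB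
  have hopE : ∀ p q, C₁.op E p q = C.op E p q := by
    intro p q
    show C.op E (p ^^ (finTwoEquiv c' && decide (C.arg E 0 = .var x))) (q ^^ (finTwoEquiv c' && decide (C.arg E 1 = .var x))) = _
    rw [decide_eq_false (hE_x 0), decide_eq_false (hE_x 1), Bool.and_false, Bool.xor_false, Bool.xor_false]
  -- step 1: `B` is the constant `kE`
  have hid : ∀ (xx : Fin n → Bool) (w : Fin C₁.m → Bool),
      C₁.op B (C₁.nodeVal xx w (C₁.arg B 0)) (C₁.nodeVal xx w (C₁.arg B 1)) = kE := by
    intro xx w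
    rw [hwB 0, hwB 1]
    show (C.substVar x t (finTwoEquiv c')).op B (xx t) (xx t) = kE
    rw [hb']; exact hcB _
  have hselfB : ∀ a, C₁.arg B a ≠ .gate B := by intro a h; rw [hwB a] at h; cases h
  have houtB : C₁.out ≠ .gate B :=
    out_ne_of_semConst hf (by omega) hF₁ hC₁ (fun xx w hw => by rw [hw B]; exact hid xx w)
  let E₁ := elimDataWRedirectConst hF₁ hC₁ hP₁ kE hid (Or.inl (by rw [hwB 0, hwB 1])) hselfB houtB hφ hI αQ
  have hrepl₁ : E₁.repl = .const kE := rfl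
  obtain ⟨kE₁, hkE₁⟩ := E₁.ι_surj E hEB'
  obtain ⟨kF₁, hkF₁⟩ := E₁.ι_surj F hFB'
  have hkEF : kE₁ ≠ kF₁ := fun h => hFE (by rw [← hkF₁, ← hkE₁, h])
  have hE₁c : E₁.C'.arg kE₁ aE = .const kE :=
    (E₁.arg_eq_const_iff kE₁ aE kE).mpr (Or.inr ⟨by rw [hkE₁]; exact hEB₁, hrepl₁⟩)
  have hF₁c : E₁.C'.arg kF₁ aF = .const kE :=
    (E₁.arg_eq_const_iff kF₁ aF kE).mpr (Or.inr ⟨by rw [hkF₁]; exact hFB₁, hrepl₁⟩)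
  have hopE₁ : ∀ p q, E₁.C'.op kE₁ p q = C.op E p q := by
    intro p q; rw [elimDataWRedirectConst_op, hkE₁]; exact hopE p q
  -- step 2: `E` is trivialized
  have htrivE : E₁.C'.liveFn kE₁ aE kE false = E₁.C'.liveFn kE₁ aE kE true := by
    unfold liveFn at hkE ⊢
    split_ifs at hkE ⊢ with h
    · rw [hopE₁, hopE₁]; exact hkE
    · rw [hopE₁, hopE₁]; exact hkE
  have houtE : E₁.C'.out ≠ .gate kE₁ := out_ne_of_trivialized hf (by omega) E₁.fair E₁.computes hE₁c htrivE
  let E₂ := elimDataWTriv E₁.fair E₁.computes E₁.packing hE₁c htrivE houtE hφ hI αQ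
  have hrepl₂ : E₂.repl = .const (E₁.C'.liveFn kE₁ aE kE false) := rfl
  -- step 3: two doomed gates in `E₂.C'`: `F` (fed by the constant `B`) and a reader of `E`, or of `F`
  obtain ⟨kF₂, hkF₂⟩ := E₂.ι_surj kF₁ hkEF.symm
  have hF₂c : E₂.C'.arg kF₂ aF = .const kE := (E₂.arg_eq_const_iff kF₂ aF kE).mpr (Or.inl (by rw [hkF₂]; exact hF₁c))
  have hF₂doomed : kF₂ ∈ E₂.C'.doomed := E₂.C'.mem_doomed_of_const hF₂c
  have hE1 : 1 ≤ C.fanout (.gate E) := by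
    by_contra h0
    have h0' : C.fanout (.gate E) = 0 := by omega
    exact false_of_and_out_reads_var hf (by omega) hF hC (hN.out_of_fanout_eq_zero E h0') hEand hEz
  obtain ⟨H, aH, hHE⟩ := exists_reader_of_fanout_pos (D := C) (by omega : 0 < C.fanout (.gate E))
  have hHE' : H ≠ E := fun h => by rw [h] at hHE; exact C.arg_ne_self_of_not_mem hEK _ hHE
  have hHB : H ≠ B := by
    intro h; rw [h] at hHE
    rcases fin2_eq_or_eq_rev aB aH with e' | e'
    · rw [e', hBx] at hHE; cases hHE
    · rw [e', hBt] at hHE; cases hHE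
  obtain ⟨kH₁, hkH₁⟩ := E₁.ι_surj H hHB
  have hkHE : kH₁ ≠ kE₁ := fun h => hHE' (by rw [← hkH₁, ← hkE₁, h])
  obtain ⟨kH₂, hkH₂⟩ := E₂.ι_surj kH₁ hkHE
  have hH₁E : E₁.C'.arg kH₁ aH = .gate kE₁ := by
    rw [E₁.arg_eq_gate_iff, hkH₁, hkE₁]; exact Or.inl (hgate₁.mpr hHE)
  have hH₂c : E₂.C'.arg kH₂ aH = .const (E₁.C'.liveFn kE₁ aE kE false) :=
    (E₂.arg_eq_const_iff kH₂ aH _).mpr (Or.inr ⟨by rw [hkH₂]; exact hH₁E, hrepl₂⟩)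
  have hH₂doomed : kH₂ ∈ E₂.C'.doomed := E₂.C'.mem_doomed_of_const hH₂c
  have houtchain : C.out = .gate F → E₂.C'.out = .gate kF₂ := by
    intro hh
    have h1 := E₁.out_eq; rw [if_neg houtB] at h1
    have h2 := E₂.out_eq; rw [if_neg houtE] at h2
    have ho₁ : E₁.C'.out = .gate kF₁ := by
      apply E₁.embed_injective
      show E₁.C'.out.embed E₁.ι = (Node.gate kF₁ : Node n _).embed E₁.ι
      rw [h1]; show C₁.out = Node.gate (E₁.ι kF₁); rw [hkF₁]
      show C.out.substVar x t = _; rw [hh]; rfl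
    apply E₂.embed_injective
    show E₂.C'.out.embed E₂.ι = (Node.gate kF₂ : Node n _).embed E₂.ι
    rw [h2]; show E₁.C'.out = Node.gate (E₂.ι kF₂); rw [hkF₂]; exact ho₁
  have htwo : 2 ≤ E₂.C'.doomed.card := by
    by_cases hHF : H = F
    · -- `H = F` reads `B` and `E`: it becomes syntactically constant; it is not the output, so it has a reader, doomed too
      have haHF : aH ≠ aF := by
        intro h; have h' := hHE; rw [hHF, h, hFB] at h'; cases h'; exact hEB' rfl
      have hF₁E : E₁.C'.arg kF₁ aH = .gate kE₁ := by
        rw [E₁.arg_eq_gate_iff, hkF₁, hkE₁]; left; rw [← hHF]; exact hgate₁.mpr hHE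
      have hF₂c' : E₂.C'.arg kF₂ aH = .const (E₁.C'.liveFn kE₁ aE kE false) :=
        (E₂.arg_eq_const_iff kF₂ aH _).mpr (Or.inr ⟨by rw [hkF₂]; exact hF₁E, hrepl₂⟩)
      have hsyn : ∃ bb, E₂.C'.SynVal (.gate kF₂) bb := by
        rcases fin2_eq_or_eq_rev 0 aF with e0 | e0
        · have e1 : aH = 1 := by
            rcases fin2_eq_or_eq_rev 0 aH with e1 | e1
            · exact absurd (e1.trans e0.symm) haHF
            · rw [e1]; rfl
          rw [e0] at hF₂c; rw [e1] at hF₂c'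
          exact ⟨_, SynVal.both (by rw [hF₂c]; exact SynVal.const _) (by rw [hF₂c']; exact SynVal.const _) rfl⟩
        · have e0' : aF = 1 := by rw [e0]; rfl
          have e1 : aH = 0 := by
            rcases fin2_eq_or_eq_rev 0 aH with e1 | e1
            · exact e1
            · exact absurd ((show aH = 1 by rw [e1]; rfl).trans e0'.symm) haHF
          rw [e0'] at hF₂c; rw [e1] at hF₂c'
          exact ⟨_, SynVal.both (by rw [hF₂c']; exact SynVal.const _) (by rw [hF₂c]; exact SynVal.const _) rfl⟩
      obtain ⟨bb, hbb⟩ := hsyn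
      have hFout : C.out ≠ .gate F := fun hh =>
        out_ne_of_synVal hf (by omega) E₂.fair E₂.computes hbb (houtchain hh)
      have hFpos : 0 < C.fanout (.gate F) := by
        by_contra hh; push Not at hh
        exact hFout (hN.out_of_fanout_eq_zero F (by omega))
      obtain ⟨K, aK, hKF⟩ := exists_reader_of_fanout_pos (D := C) hFpos
      have hKB : K ≠ B := by
        intro hh; rw [hh] at hKF
        rcases fin2_eq_or_eq_rev aB aK with e' | e'
        · rw [e', hBx] at hKF; cases hKF
        · rw [e', hBt] at hKF; cases hKF
      have hKE : K ≠ E := by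
        intro hh; rw [hh] at hKF
        rcases fin2_eq_or_eq_rev aE aK with e' | e'
        · rw [e', hEB] at hKF; cases hKF; exact hFB' rfl
        · rw [e', hEz] at hKF; cases hKF
      have hKF' : K ≠ F := fun hh => by
        rw [hh] at hKF
        exact not_reads_self_of_standing hF hN hS.nonDegenerate F aK hKF
      obtain ⟨kK₁, hkK₁⟩ := E₁.ι_surj K hKB
      have hkKE : kK₁ ≠ kE₁ := fun hh => hKE (by rw [← hkK₁, ← hkE₁, hh])
      obtain ⟨kK₂, hkK₂⟩ := E₂.ι_surj kK₁ hkKE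
      have hK₁F : E₁.C'.arg kK₁ aK = .gate kF₁ := by
        rw [E₁.arg_eq_gate_iff, hkK₁, hkF₁]; exact Or.inl (hgate₁.mpr hKF)
      have hK₂F : E₂.C'.arg kK₂ aK = .gate kF₂ := by
        rw [E₂.arg_eq_gate_iff, hkK₂, hkF₂]; exact Or.inl hK₁F
      have hK₂doomed : kK₂ ∈ E₂.C'.doomed := E₂.C'.mem_doomed_of_reads hK₂F hbb
      have hkKF : kK₂ ≠ kF₂ := by
        intro hh
        have := congrArg E₂.ι hh; rw [hkK₂, hkF₂] at this
        have := congrArg E₁.ι this; rw [hkK₁, hkF₁] at this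
        exact hKF' this
      have hsub : ({kK₂, kF₂} : Finset _) ⊆ E₂.C'.doomed := by
        intro k hk; rw [mem_insert, mem_singleton] at hk
        rcases hk with rfl | rfl
        · exact hK₂doomed
        · exact hF₂doomed
      have := card_le_card hsub
      rwa [card_pair hkKF] at this
    · have hkHF : kH₂ ≠ kF₂ := by
        intro hh
        have := congrArg E₂.ι hh; rw [hkH₂, hkF₂] at this
        have := congrArg E₁.ι this; rw [hkH₁, hkF₁] at this
        exact hHF this
      have hsub : ({kH₂, kF₂} : Finset _) ⊆ E₂.C'.doomed := by
        intro k hk; rw [mem_insert, mem_singleton] at hk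
        rcases hk with rfl | rfl
        · exact hH₂doomed
        · exact hF₂doomed
      have := card_le_card hsub
      rwa [card_pair hkHF] at this
  obtain ⟨D', P', hF', hCD', hP', hm', hμ'⟩ := cascade_doomed hf hd₁ hφ hI αQ 2 E₂.C' E₂.P' E₂.fair E₂.computes E₂.packing htwo
  -- accounting: `μ(C₁) ≤ μ(C) - α_I`, then four eliminations of gain `1 - α_φ` each
  have hinf₁ : ((C₁.influential R₁).card : ℝ) + 1 ≤ (C.influential R).card := by
    have hfreej : ¬ R₁.Free x := fun h => ((hfree x).mp h).2 rfl
    have hprot : ∀ i, R₁.Protected i → R.Protected i := fun i h => (RdqSource.protected_assignLin_iff hx hxp hEq i).mp h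
    have h1 := C.influential_substVar_subset x t (finTwoEquiv c') (fun h => hxt h.symm) hfreej hprot
    have h2 : insert t ((C.influential R).erase x) = (C.influential R).erase x :=
      insert_eq_of_mem (mem_erase.mpr ⟨fun h => hxt h.symm, htinf⟩)
    rw [h2] at h1
    have h3 := card_le_card h1
    change (C₁.influential R₁).card ≤ _ at h3
    have h4 := card_erase_add_one hxinf
    have : (C₁.influential R₁).card + 1 ≤ (C.influential R).card := by omega
    exact_mod_cast this
  have hq : (R₁.quadCount : ℝ) = R.quadCount := rfl
  have hμ₁ : C₁.measure αφ αI αQ P₁ R₁ ≤ C.measure αφ αI αQ ∅ R - αI := by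
    unfold measure
    rw [hq]
    show ((C.m : ℕ) : ℝ) + _ + _ + _ ≤ _
    nlinarith [mul_le_mul_of_nonneg_left hinf₁ hI, mul_le_mul_of_nonneg_left hpot₁ hφ]
  have hμE₁ := E₁.measure_le
  have hμE₂ := E₂.measure_le
  refine Or.inr ⟨1, le_rfl, by norm_num, D', R₁, P', hF', hCD', hP', RdqSource.dim_assignLin hx hxp hEq, ?_⟩
  have hδ := liYangDelta_le_case3 αφ αI αQ
  push_cast at hμ'
  simp only [Nat.cast_one, mul_one]
  linarith

end Semicircuit

end Literature.Computability.Complexity
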